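import Summits.BirchSwinnertonDyer.BirchSwinnertonDyer.Theorems.KimAtThreeFineKatoKPortJunctionUnit
import Literature.NumberTheory.AdelicBaseChange.CyclotomicCompletionTowerProofs
import HarnessLib

/-!
# K-PORT junction at the WILD levels `m = 3·m′`: hKloc/hLog clause (d) at a factor `w ∣ 3` of `ℚ(ζ_{3m′})`
# read over the UNRAMIFIED subfield `ℚ₃(ζ_{m′})` — road (R-b)
# (cell `bsd-addord`, seat w2-acc4 gen 5; `--supports stmt-BirchSwinnertonDyer-19560`, helper)

HONEST FRAMING. Route W2 (`route-BirchSwinnertonDyer-KimAtThreeKolyvagin`), crux 19560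
`KatoKuriharaPortThreeShared`, registered line `perFactorKato` (stub `hKloc`, kim3 LEAD), clause (d) of
`hKloc` / of the part `hLog`: per factor `w ∣ 3` of `L = ℚ(ζ_m)`, `m = cycLevel 3 0 r`, a log-lattice
`Λ₀ʷ ⊆ 𝒪_w ∋ 0` with ONE element of unit trace `‖e₃⁻¹ Tr_{L_w/ℚ_v} ℓ₀‖ = 1`.  At the TAME levels
(`3 ∤ m`, `e(w∣3) = 1`) this is w2-kport's `KPort.clause_d_unit_package` (file `…KPortJunctionUnit`), the
K-port consumer run inside the unramified `K_w`.  The registered stub quantifies over ALL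
`r : Finset (HeightOneSpectrum (𝓞 ℚ))` (w2-acc4 g5 FINDING-R3, 2026-08-27), so the levels `r ∋ v₃`, i.e.
`m = 3·m′` with `3 ∤ m′`, where EVERY `w ∣ 3` is ramified (`e = 2`, `π = ζ₃ − 1`), must be served too —
decision (R-b) of the crux LEAD (kim3 g14): read `L_w` over its unramified subfield.  THIS FILE does
exactly that: for a subfield `F ⊆ L` with `IsCyclotomicExtension {m′} ℚ F` (it exists:
`Literature.….exists_intermediateField_isCyclotomicExtension`, `F = ℚ(ζ^3)`) and the place `u = w ∩ 𝓞 F`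
(unramified over `3`: `Kw.ramificationIdx_eq_one_of_isCyclotomicExtension m′`), run `clause_d_unit_package`
in `K_u = F_u` and PUSH its set along the packet map `ι : F_u → L_w`:

* `clause_d_unit_package_wild` — **`Λ₀ʷ := ι '' {Λ̃ P : P ∈ E₀(K_u)} ⊆ 𝒪_w`, `0 ∈ Λ₀ʷ`, and
  `∃ ℓ₀ ∈ Λ₀ʷ, ‖e₃⁻¹(Tr_{L_w/ℚ_v} ℓ₀)‖ = 1`** — `ι` preserves integrality
  (`valued_adicCompletionSemialgHom_le_one_iff`), and `Tr_{L_w/ℚ_v}(ι x) = n · Tr_{F_u/ℚ_v}(x)` with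
  `3 ∤ n` (`exists_trace_adicCompletionSemialgHom_eq_nsmul_not_dvd`: `n = [L_w : F_u] ≤ [L : F] = 2`), so the
  unit trace survives (`‖n‖₃ = 1`).
* `exists_extension_under` — the place `u` of `F` below `w` as an element of `v₀.Extension (𝓞 F)`.

TOOL theorems only (no definition, no named fact, no `sorry`); closes nothing by itself; nothing booked; BSD /
19560 are not proved by any of this.  What it does NOT contain: clause (e) at `w` (Tate duality at
`K = L_w`, see w2-acc4 g5 FINDING-E: it needs a rigid form of the typed (S5b)), the choice of `F` inside the
consumer's `CyclotomicField (cycLevel 3 0 r) ℚ`, and the tame levels (`…KPortJunctionUnit`).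

References: J. Neukirch, *Algebraic Number Theory* (1999), Ch. II (7.12)–(7.13) (`ℚ_p(ζ_{m′})` is the maximal
unramified subextension of `ℚ_p(ζ_{p m′})`) [NeukirchANT1999]; J. W. S. Cassels, A. Fröhlich, *Algebraic Number
Theory* (1967), Ch. II §10–§11 [CasselsFrohlichANT1967]; J. H. Silverman, *AEC* (2009), IV.6.4, VII.2
[SilvermanAEC2009]; kim3 memo KIM3-W2-C1c-SEMILOCAL-g14 §7; w2-kport STATUS 2026-08-27 06:53Z (3).
-/

noncomputable section

-- the cell's Theorems namespace `Summit.BirchSwinnertonDyer.BirchSwinnertonDyer.…` repeats the summit name by design (D-0017)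
set_option linter.dupNamespace false

open scoped NNReal
open IsDedekindDomain NumberField
open Literature.NumberTheory.AdelicBaseChange

namespace Summit.BirchSwinnertonDyer.BirchSwinnertonDyer.Theorems.KPort

section Places

variable {F L : Type} [Field F] [NumberField F] [Field L] [NumberField L] [Algebra F L]
  (v : HeightOneSpectrum (𝓞 ℚ)) (w : v.Extension (𝓞 L))

/-- The place `u := w ∩ 𝓞 F` of a subfield `F ⊆ L` below `w ∣ v` lies above `v`. -/
theorem exists_extension_under : ∃ u : v.Extension (𝓞 F), w.1.under (𝓞 F) = u.1 :=
  ⟨⟨w.1.under (𝓞 F), by rw [under_under_ringOfIntegers ℚ F L]; exact w.2⟩, rfl⟩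

end Places

section ClauseDWild

open Summit.BirchSwinnertonDyer.Rank1Residual.Additive Summit.BirchSwinnertonDyer.Rank1Residual.Additive.BallEval
open Summit.BirchSwinnertonDyer.Rank1Residual.Additive.LocalLog Literature.NumberTheory.EllipticCurves.Rank1Residual
open WeierstrassCurve

variable {F L : Type} [Field F] [NumberField F] [Field L] [NumberField L] [Algebra F L] [IsScalarTower ℚ F L]
  (m' : ℕ) [NeZero m'] [IsCyclotomicExtension {3 * m'} ℚ L] [IsCyclotomicExtension {m'} ℚ F]
  (u : ((Rat.HeightOneSpectrum.primesEquiv (R := 𝓞 ℚ)).symm ⟨3, Fact.out⟩).Extension (𝓞 F))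
  (w : ((Rat.HeightOneSpectrum.primesEquiv (R := 𝓞 ℚ)).symm ⟨3, Fact.out⟩).Extension (𝓞 L))
  (hwu : w.1.under (𝓞 F) = u.1)

/-- The norm of a natural number prime to `3` in `ℚ_[3]` is `1`. -/
private theorem padicNorm_natCast_eq_one {n : ℕ} (hn : ¬ 3 ∣ n) : ‖((n : ℕ) : ℚ_[3])‖ = 1 := by
  refine le_antisymm (by exact_mod_cast Padic.norm_int_le_one (n : ℤ)) (not_lt.mp fun h ↦ hn ?_)
  have h' : ‖((n : ℤ) : ℚ_[3])‖ < 1 := by exact_mod_cast h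
  exact_mod_cast (Padic.norm_intCast_lt_one_iff (k := (n : ℤ))).mp h'

open scoped Classical in
/-- **hKloc / hLog clause (d) at a factor `w ∣ 3` of a WILD level `m = 3·m′` (`3 ∤ m′`), all three inputs
verbatim, by the unramified-subfield road (R-b).**  For `W/ℚ` globally minimal with `Addv W 3` on the Kato
stratum `#E(ℚ₃)[3] = 1`, `L/ℚ` `{3·m′}`-cyclotomic, `F ⊆ L` `{m′}`-cyclotomic, `u = w ∩ 𝓞 F` and
`ι = Extension.adicCompletionSemialgHom F L ⟨w, _⟩ : F_u → L_w` (`e(u∣3) = 1` as a `Fact`, discharged by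
`Kw.ramificationIdx_eq_one_of_isCyclotomicExtension m′`): the set
`Λ₀ʷ := ι '' {Λ̃ P : P ∈ E₀(K_u)}` (logarithms of the points of the UNRAMIFIED field `K_u = F_u`, pushed
into `L_w`) satisfies `Λ₀ʷ ⊆ 𝒪_w`, `0 ∈ Λ₀ʷ`, and **`∃ ℓ₀ ∈ Λ₀ʷ, ‖e₃⁻¹(Tr_{L_w/ℚ_v} ℓ₀)‖ = 1`**
(`Tr_{L_w/ℚ_v} ∘ ι = n · Tr_{F_u/ℚ_v}` with `3 ∤ n`). -/
theorem clause_d_unit_package_wild (hm' : ¬ 3 ∣ m')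
    [he : Fact (u.1.asIdeal.ramificationIdx (𝓞 ℚ) = 1)]
    (W : WeierstrassCurve ℚ) [W.IsElliptic] [W.IsGloballyMinimal]
    [hE : (((integralModelInt W).map (Int.castRingHom ℤ_[3])).map PadicInt.Coe.ringHom).IsElliptic]
    [hX : (((integralModelInt W).map (Int.castRingHom ℤ_[3])).map PadicInt.Coe.ringHom).IsIntegral ℤ_[3]]
    [hX' : (((integralModelInt W).map (Int.castRingHom ℤ_[3])).map PadicInt.Coe.ringHom).IsIntegral
      (NormedField.valuation (K := ℚ_[3])).integer]
    [hmin : (((integralModelInt W).map (Int.castRingHom ℤ_[3])).map PadicInt.Coe.ringHom).IsMinimal ℤ_[3]]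
    [hint : (curveK 3 (Kw 3 F u) ((integralModelInt W).map (Int.castRingHom ℤ_[3]))).IsIntegral
      (NormedField.valuation (K := Kw 3 F u)).integer]
    (hadd : Addv W 3) (ht : Nat.card {Q : (W.baseChange ℚ_[3]).toAffine.Point // (3 : ℕ) • Q = 0} = 1) :
    (HeightOneSpectrum.Extension.adicCompletionSemialgHom F L (⟨w.1, hwu⟩ : u.1.Extension (𝓞 L)) ''
        {x : u.1.adicCompletion F | ∃ P ∈ (((integralModelInt W).map (Int.castRingHom ℤ_[3])).map
          (coeffHom 3 (Kw 3 F u))).nonsingularReductionSubgroup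
          (Valuation.integer.integers (NormedField.valuation (K := Kw 3 F u))),
        Kw.toCompletion 3 F u (satLog 3 (Kw 3 F u) ((integralModelInt W).map (Int.castRingHom ℤ_[3])) P) = x} ⊆
      w.1.adicCompletionIntegers L) ∧
    ((0 : w.1.adicCompletion L) ∈
      HeightOneSpectrum.Extension.adicCompletionSemialgHom F L (⟨w.1, hwu⟩ : u.1.Extension (𝓞 L)) ''
        {x : u.1.adicCompletion F | ∃ P ∈ (((integralModelInt W).map (Int.castRingHom ℤ_[3])).map
          (coeffHom 3 (Kw 3 F u))).nonsingularReductionSubgroup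
          (Valuation.integer.integers (NormedField.valuation (K := Kw 3 F u))),
        Kw.toCompletion 3 F u (satLog 3 (Kw 3 F u) ((integralModelInt W).map (Int.castRingHom ℤ_[3])) P) = x}) ∧
    (∃ ℓ₀ ∈ HeightOneSpectrum.Extension.adicCompletionSemialgHom F L (⟨w.1, hwu⟩ : u.1.Extension (𝓞 L)) ''
        {x : u.1.adicCompletion F | ∃ P ∈ (((integralModelInt W).map (Int.castRingHom ℤ_[3])).map
          (coeffHom 3 (Kw 3 F u))).nonsingularReductionSubgroup
          (Valuation.integer.integers (NormedField.valuation (K := Kw 3 F u))),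
        Kw.toCompletion 3 F u (satLog 3 (Kw 3 F u) ((integralModelInt W).map (Int.castRingHom ℤ_[3])) P) = x},
      ‖(Padic.adicCompletionEquiv (𝓞 ℚ) ⟨3, Fact.out⟩).symm
          (Algebra.trace (((Rat.HeightOneSpectrum.primesEquiv (R := 𝓞 ℚ)).symm ⟨3, Fact.out⟩).adicCompletion ℚ)
            (w.1.adicCompletion L) ℓ₀)‖ = 1) := by
  obtain ⟨hsub, h0, ℓ₀, hℓ₀, hunit⟩ := clause_d_unit_package u m' W hadd ht
  set ι := HeightOneSpectrum.Extension.adicCompletionSemialgHom F L (⟨w.1, hwu⟩ : u.1.Extension (𝓞 L))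
    with hι
  refine ⟨?_, ⟨0, h0, map_zero ι⟩, ?_⟩
  · -- `ι` preserves integrality
    rintro _ ⟨x, hx, rfl⟩
    have hx' : Valued.v x ≤ 1 := (HeightOneSpectrum.mem_adicCompletionIntegers _ _ _).mp (hsub hx)
    exact (HeightOneSpectrum.mem_adicCompletionIntegers _ _ _).mpr
      ((valued_adicCompletionSemialgHom_le_one_iff ℚ F L _ u w hwu x).mpr hx')
  · -- the unit trace survives: `Tr_{L_w/ℚ_v}(ι ℓ₀) = n • Tr_{F_u/ℚ_v}(ℓ₀)`, `3 ∤ n`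
    obtain ⟨n, hn, htr⟩ :=
      exists_trace_adicCompletionSemialgHom_eq_nsmul_not_dvd L 3 m' F hm' _ u w hwu
    refine ⟨ι ℓ₀, ⟨ℓ₀, hℓ₀, rfl⟩, ?_⟩
    rw [htr, map_nsmul, nsmul_eq_mul, norm_mul, padicNorm_natCast_eq_one hn, one_mul]
    exact hunit

end ClauseDWild

end Summit.BirchSwinnertonDyer.BirchSwinnertonDyer.Theorems.KPort

end
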